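import Mathlib

/-!
# Harris with a symmetric log-supermodular weight on a finite distributive lattice (blind cell
PercRepro2, p3 g28, 2026-08-28; `proofs/P3-PENDANT.md` §2 (iv))

The Harris step of CLASS C4 of the single-`d` statement (the pendant pocket region): on a
finite distributive lattice `α` with an involution `κ`, a weight `μ ≥ 0` that is
log-supermodular and `κ`-symmetric, a monotone `f` that is `κ`-odd and an antitone `g` give
`∑ x, μ x * (f x * g x) ≤ 0` (`sum_weight_mul_nonpos`).  Proof: the weighted mean of `f`
vanishes by the bijection `κ` (`sum_weight_mul_eq_zero`), and Mathlib's FKG inequality (`fkg`)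
for the shifted non-negative monotone functions `f + k` and `k' − g` gives
`(∑ μ) · (∑ μ f g) ≤ (∑ μ f) · (∑ μ g) = 0`.  The indicator of a self-dual sublattice is the
special case `M9LatticeHarrisGen`; here the weight is the count of legal pocket colourings, a
function of the status of `d` alone.  Own work; std axioms.
-/

namespace Summit.Ventures.PercRepro2

namespace M9Reduce

open Finset

variable {α : Type*} [Fintype α] [DecidableEq α] [DistribLattice α]

omit [Fintype α] [DecidableEq α] [DistribLattice α] in
/-- A `κ`-symmetric weight against a `κ`-odd function sums to zero, for an involution `κ`. -/
lemma sum_weight_mul_eq_zero [Fintype α] {κ : α → α} (hκ : ∀ x, κ (κ x) = x) {μ f : α → ℤ}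
    (hμκ : ∀ x, μ (κ x) = μ x) (hfκ : ∀ x, f (κ x) = -f x) :
    ∑ x, μ x * f x = 0 := by
  have hbij : ∑ x, μ (κ x) * f (κ x) = ∑ x, μ x * f x :=
    Finset.sum_nbij' κ κ (fun x _ => Finset.mem_univ _) (fun x _ => Finset.mem_univ _)
      (fun x _ => hκ x) (fun x _ => hκ x) (fun x _ => rfl)
  have hneg : ∑ x, μ (κ x) * f (κ x) = -∑ x, μ x * f x := by
    rw [← Finset.sum_neg_distrib]
    refine Finset.sum_congr rfl fun x _ => ?_
    rw [hμκ x, hfκ x]; ring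
  linarith

omit [DecidableEq α] in
/-- **Harris with a symmetric log-supermodular weight.** For a weight `μ ≥ 0` with
`μ a * μ b ≤ μ (a ⊓ b) * μ (a ⊔ b)` and `μ (κ x) = μ x` for an involution `κ`, a monotone `f`
with `f (κ x) = -f x` and an antitone `g`: `∑ x, μ x * (f x * g x) ≤ 0`. -/
theorem sum_weight_mul_nonpos {κ : α → α} (hκ : ∀ x, κ (κ x) = x) {μ : α → ℤ} (hμ₀ : 0 ≤ μ)
    (hμ : ∀ a b, μ a * μ b ≤ μ (a ⊓ b) * μ (a ⊔ b)) (hμκ : ∀ x, μ (κ x) = μ x)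
    {f g : α → ℤ} (hf : Monotone f) (hfκ : ∀ x, f (κ x) = -f x) (hg : Antitone g) :
    ∑ x, μ x * (f x * g x) ≤ 0 := by
  classical
  -- shifts making the two functions non-negative
  let k : ℤ := ∑ x, |f x|
  let k' : ℤ := ∑ x, |g x|
  let F : α → ℤ := fun x => f x + k
  let K : α → ℤ := fun x => k' - g x
  have habsf : ∀ x, |f x| ≤ k := fun x =>
    Finset.single_le_sum (f := fun x => |f x|) (fun x _ => abs_nonneg _) (Finset.mem_univ x)
  have habsg : ∀ x, |g x| ≤ k' := fun x =>
    Finset.single_le_sum (f := fun x => |g x|) (fun x _ => abs_nonneg _) (Finset.mem_univ x)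
  have hF₀ : 0 ≤ F := by
    intro x
    have := abs_le.1 (habsf x)
    simp only [F, Pi.zero_apply]; linarith
  have hK₀ : 0 ≤ K := by
    intro x
    have := abs_le.1 (habsg x)
    simp only [K, Pi.zero_apply]; linarith
  have hFmono : Monotone F := by
    intro x y hxy
    simp only [F]
    have := hf hxy
    linarith
  have hKmono : Monotone K := by
    intro x y hxy
    simp only [K]
    have := hg hxy
    linarith
  have key := fkg F K μ hμ₀ hF₀ hK₀ hFmono hKmono hμ
  -- the weighted mean of `f` vanishes
  have hzero : ∑ x, μ x * f x = 0 := sum_weight_mul_eq_zero hκ hμκ hfκ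
  -- expand the three weighted sums
  have eF : ∑ x, μ x * F x = k * ∑ x, μ x := by
    simp only [F]
    have : ∀ x, μ x * (f x + k) = μ x * f x + k * μ x := fun x => by ring
    simp_rw [this]
    rw [Finset.sum_add_distrib, hzero, zero_add, ← Finset.mul_sum]
  have eK : ∑ x, μ x * K x = k' * ∑ x, μ x - ∑ x, μ x * g x := by
    simp only [K]
    have : ∀ x, μ x * (k' - g x) = k' * μ x - μ x * g x := fun x => by ring
    simp_rw [this]
    rw [Finset.sum_sub_distrib, ← Finset.mul_sum]
  have eFK : ∑ x, μ x * (F x * K x) =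
      -(∑ x, μ x * (f x * g x)) + k * k' * ∑ x, μ x - k * ∑ x, μ x * g x := by
    simp only [F, K]
    have : ∀ x, μ x * ((f x + k) * (k' - g x)) =
        -(μ x * (f x * g x)) + k' * (μ x * f x) + k * k' * μ x - k * (μ x * g x) :=
      fun x => by ring
    simp_rw [this]
    rw [Finset.sum_sub_distrib, Finset.sum_add_distrib, Finset.sum_add_distrib,
      Finset.sum_neg_distrib, ← Finset.mul_sum, hzero, mul_zero, add_zero, ← Finset.mul_sum,
      ← Finset.mul_sum]
  rw [eF, eK, eFK] at key
  -- `(∑ μ) * ∑ μ f g ≤ 0`, and `∑ μ ≥ 0`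
  have hμsum : 0 ≤ ∑ x, μ x := Finset.sum_nonneg fun x _ => hμ₀ x
  have hX : (∑ x, μ x) * ∑ x, μ x * (f x * g x) ≤ 0 := by nlinarith [key]
  rcases hμsum.lt_or_eq with hpos | hzero'
  · exact nonpos_of_mul_nonpos_right hX hpos
  · -- every weight vanishes
    have hall : ∀ x, μ x = 0 := fun x =>
      le_antisymm (by
        have := Finset.single_le_sum (f := μ) (fun y _ => hμ₀ y) (Finset.mem_univ x)
        linarith) (hμ₀ x)
    simp [hall]

end M9Reduce

end Summit.Ventures.PercRepro2
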